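import Summits.HodgeConjecture.HodgeConjecture.Theorems.K2E3SemisimpleOrbitChartUnitary   -- ★ (this seat): the semisimple orbit chart restricted to `U(σ, J)`
import HarnessLib

/-!
# K2 · E3 ∕ U12-d, road (S-d) file 3a — FIELD MODEL of sub-socket (S-d): near a semisimple `γ ∈ U(σ, J)(E)` every element of `U(σ, J)` is conjugate,
# BY AN ELEMENT OF `U(σ, J)`, into the Cayley slice `γ · (1+Y)(1−Y)⁻¹`, `Y` small, skew, commuting with `γ`

HCML Track B «K2-LIT», cell `pub/hodgecm-mathlib`, crux H413 = `stmt-HodgeConjecture-24833` (`--supports … --as helper`), seat `hodgecm-mathlib-K2E3-p12` (g0),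
socket #12 `sig_K2E3NormalizedCharBddNearSemisimple`, sub-socket (S-d) `subsig_K2E3CayleySliceConjugatesNhds` of `K2/K2E3-p12/g0/SUBSIGS-U12d-CayleySlice.v1…`
(ADOPTED for U12 ED. 3).  ★ `K2E3SemisimpleOrbitChartUnitary` (p855365) gives the chart `e (X, Y′) = c(X)·γ c(Y′)·c(X)⁻¹` with `e.IsImage {θX = −X ∧ θY′ = −Y′} U(σ, J)`;
THIS FILE unpacks it into the EXACT clause shape of (S-d) over a field: **`exists_nhds_conj_mem_cayleySlice`** — for `σ` continuous, `det J` a unit, `γ ∈ U(σ, J)`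
semisimple and every neighbourhood `V` of `0` in `M_n(E)` there is an open `U ∋ γ` such that every `g ∈ U(σ, J)` with `↑g ∈ U` has `x ∈ U(σ, J)` and `Y ∈ V` with
`(σY)ᵀ J = −J Y`, `γY = Yγ`, `1 ± Y` units and `x g x⁻¹ = γ·(1+Y)(1−Y)⁻¹` (take `(X, Y′) = e⁻¹(g)`, `Y := −Y′`, `x := c(X)⁻¹ = c(−X) ∈ U(σ, J)` by ★
`cayley_mem_unitaryGroupOfForm`; `c(Y′) = (1+Y)(1−Y)⁻¹`).  What is left for (S-d) on the socket's carrier `(cmDatum L N H).Local v` is TRANSPORT (file 3b): non-split `v`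
through ★ `localNonsplitEquiv` (one place, `L ⊗ L⁺_v ≃ L_w`), split `v` through ★ `localSplitEquiv` (`≃ GL_N(L_w)`, where ★ `exists_openPartialHomeomorph_cayleyConj_of_isSemisimple`
is used directly).  [HarishChandra1999 §18 p. 79 «`(x, m) ↦ xγmx⁻¹` … submersive … `(γU_M)^G` is an open neighbourhood of `γ`»]
THEOREMS ONLY; no `sorry`; axioms ⊆ the trio.  HONEST LABEL: HC_CM is proved only modulo the 7 printed citations (2 remaining named inputs: hLiu418 =
stmt-HodgeConjecture-24832, h413 = stmt-HodgeConjecture-24833) until rung 0 closes.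

## References
* [HarishChandra1999AdmissibleDistributions] Harish-Chandra (DeBacker–Sally), *Admissible Invariant Distributions on Reductive p-adic Groups* (1999), §18 p. 79.
* [HarishChandra1970] Harish-Chandra (van Dijk), *Harmonic Analysis on Reductive p-adic Groups*, LNM 162 (1970), Part I §3.
* [Weyl1939] H. Weyl, *The Classical Groups* (1939), Ch. II §10.
-/

set_option autoImplicit false
set_option linter.dupNamespace false

noncomputable section

open Filter Topology Set
open scoped Matrix.Norms.Operator Matrix

namespace Summit.HodgeConjecture.HodgeConjecture.Cruxes.H413.K2E3CayleySliceConjugatesNhdsField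

open Literature.Analysis.Calculus Literature.LinearAlgebra.Matrix Literature.NumberTheory.Automorphic
open Summit.HodgeConjecture.HodgeConjecture.Cruxes.H413.K2E3SemisimpleOrbitChartUnitary

variable {E : Type*} [NontriviallyNormedField E] [CompleteSpace E] [CharZero E] {n : Type*} [Fintype n] [DecidableEq n]

omit [CompleteSpace E] [CharZero E] in
/-- `c(−Y) = (1 + Y)(1 − Y)⁻¹` with Mathlib's matrix inverse (`Matrix.nonsing_inv_eq_ringInverse`). [cite: Weyl1939, Ch. II §10] -/
theorem cayley_neg_eq (Y : Matrix n n E) : cayley (-Y) = (1 + Y) * (1 - Y)⁻¹ := by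
  rw [cayley_def, sub_neg_eq_add, ← sub_eq_add_neg, Matrix.nonsing_inv_eq_ringInverse]

/-- **(S-d), field model — near a semisimple `γ ∈ U(σ, J)` every element of `U(σ, J)` is `U(σ, J)`-conjugate into the Cayley slice through `γ`.**
For `σ` continuous, `det J` a unit, `γ ∈ U(σ, J)` with semisimple matrix, and any `V ∈ 𝓝 0`: there is an open `U ∋ γ` in `M_n(E)` such that for every `g ∈ U(σ, J)` with
`↑g ∈ U` there are `x ∈ U(σ, J)` and `Y ∈ V` with `(σY)ᵀJ = −JY`, `γY = Yγ`, `1 − Y` and `1 + Y` units, and `x g x⁻¹ = γ·(1+Y)(1−Y)⁻¹`.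
(The chart ★ `exists_openPartialHomeomorph_cayleyConj_isImage_unitary_of_isSemisimple`; `x = c(X)⁻¹ = c(−X) ∈ U(σ, J)`, `Y = −Y′`.)
[cite: HarishChandra1999AdmissibleDistributions, §18 p. 79] [cite: HarishChandra1970, Part I §3] [cite: Weyl1939, Ch. II §10] -/
theorem exists_nhds_conj_mem_cayleySlice (σ : E →+* E) (hσ : Continuous σ) {J : Matrix n n E} (hJ : IsUnit J.det)
    (γ : GL n E) (hγU : γ ∈ unitaryGroupOfForm σ J) (hγ : Module.End.IsSemisimple (Matrix.toLin' (γ : Matrix n n E)))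
    (V : Set (Matrix n n E)) (hV : V ∈ 𝓝 (0 : Matrix n n E)) :
    ∃ U : Set (Matrix n n E), IsOpen U ∧ (γ : Matrix n n E) ∈ U ∧
      ∀ g ∈ unitaryGroupOfForm σ J, (g : Matrix n n E) ∈ U →
        ∃ x ∈ unitaryGroupOfForm σ J, ∃ Y ∈ V,
          (Y.map σ)ᵀ * J = -(J * Y) ∧ (γ : Matrix n n E) * Y = Y * (γ : Matrix n n E) ∧ IsUnit (1 - Y) ∧ IsUnit (1 + Y) ∧
          ((x * g * x⁻¹ : GL n E) : Matrix n n E) = (γ : Matrix n n E) * ((1 + Y) * (1 - Y)⁻¹) := by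
  set ad : Module.End E (Matrix n n E) :=
    LinearMap.mulLeft E (γ : Matrix n n E) - LinearMap.mulRight E (γ : Matrix n n E) with had
  obtain ⟨e, h0, -, he, hunits, hI⟩ := exists_openPartialHomeomorph_cayleyConj_isImage_unitary_of_isSemisimple σ hσ hJ γ hγU hγ
  -- the coordinate `Y′ ↦ −Y′` is continuous, so `{p | −↑p.2 ∈ V}` is a neighbourhood of `0`
  have hf : Continuous fun p : ↥(LinearMap.range ad) × ↥(LinearMap.ker ad) => -((p.2 : Matrix n n E)) :=
    (continuous_subtype_val.comp continuous_snd).neg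
  have hPV : (fun p : ↥(LinearMap.range ad) × ↥(LinearMap.ker ad) => -((p.2 : Matrix n n E))) ⁻¹' V ∈
      𝓝 (0 : ↥(LinearMap.range ad) × ↥(LinearMap.ker ad)) := by
    refine hf.continuousAt.preimage_mem_nhds ?_
    simpa only [Prod.snd_zero, ZeroMemClass.coe_zero, neg_zero] using hV
  obtain ⟨P, hPsub, hPo, h0P⟩ := mem_nhds_iff.1 hPV
  refine ⟨e '' (e.source ∩ P), e.isOpen_image_of_subset_source (e.open_source.inter hPo) Set.inter_subset_left, ?_, ?_⟩
  · refine ⟨0, ⟨h0, h0P⟩, ?_⟩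
    rw [he]
    simp only [Prod.fst_zero, Prod.snd_zero, ZeroMemClass.coe_zero, cayley_zero, Ring.inverse_one, mul_one, one_mul]
  · rintro g hgU ⟨p, ⟨hps, hpP⟩, hpg⟩
    -- `p` is `θ`-skew by `IsImage`, and `1 ± X`, `1 ± Y′` are units on the source
    have hskew := (hI hps).1 ⟨g, hgU, hpg.symm⟩
    obtain ⟨hX, hY'⟩ := hskew
    obtain ⟨hxp, hxm, hyp, hym⟩ := hunits p hps
    set X : Matrix n n E := (p.1 : Matrix n n E) with hXdef
    set Y' : Matrix n n E := (p.2 : Matrix n n E) with hY'def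
    -- the conjugator `x = c(X)⁻¹ ∈ U(σ, J)`
    obtain ⟨u, huU, hu⟩ := cayley_mem_unitaryGroupOfForm σ hJ hX hxp hxm
    have hYV : -Y' ∈ V := hPsub hpP
    refine ⟨u⁻¹, (unitaryGroupOfForm σ J).inv_mem huU, -Y', hYV, ?_, ?_, ?_, ?_, ?_⟩
    · -- skewness in the socket's spelling
      have hmn : (-Y').map ⇑σ = -(Y'.map ⇑σ) := by
        ext i j
        simp only [Matrix.map_apply, Matrix.neg_apply, map_neg]
      have hθ : J⁻¹ * ((-Y').map σ)ᵀ * J = Y' := by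
        rw [hmn, Matrix.transpose_neg, Matrix.mul_neg, Matrix.neg_mul, hY', neg_neg]
      have h := congrArg (fun W => J * W) hθ
      simp only [← Matrix.mul_assoc, Matrix.mul_nonsing_inv J hJ, Matrix.one_mul] at h
      rw [h, Matrix.mul_neg, neg_neg]
    · -- `Y′ ∈ C(γ)`
      have hk := p.2.2
      rw [LinearMap.mem_ker, LinearMap.sub_apply, LinearMap.mulLeft_apply, LinearMap.mulRight_apply, sub_eq_zero] at hk
      rw [Matrix.mul_neg, Matrix.neg_mul, hY'def, hk]
    · rwa [sub_neg_eq_add]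
    · rwa [← sub_eq_add_neg]
    · -- `c(X)⁻¹ · (c(X) γ c(Y′) c(X)⁻¹) · c(X) = γ c(Y′) = γ (1+Y)(1−Y)⁻¹`
      have hcinv : Ring.inverse (cayley X) = cayley (-X) := ringInverse_cayley hxp hxm
      have hu' : ((u⁻¹ : GL n E) : Matrix n n E) = cayley (-X) := by
        rw [Matrix.coe_units_inv, hu, Matrix.nonsing_inv_eq_ringInverse, hcinv]
      rw [Units.val_mul, Units.val_mul, inv_inv, hu', hu, ← hpg, he p, hcinv, ← cayley_neg_eq (-Y'), neg_neg]
      calc cayley (-X) * (cayley X * ((γ : Matrix n n E) * cayley Y') * cayley (-X)) * cayley X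
          = (cayley (-X) * cayley X) * ((γ : Matrix n n E) * cayley Y') * (cayley (-X) * cayley X) := by
            simp only [Matrix.mul_assoc]
        _ = (γ : Matrix n n E) * cayley Y' := by
            rw [cayley_neg_mul_cayley hxp hxm, Matrix.one_mul, Matrix.mul_one]

end Summit.HodgeConjecture.HodgeConjecture.Cruxes.H413.K2E3CayleySliceConjugatesNhdsField

end
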